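import Literature.NumberTheory.EllipticCurves.FormalGroupFrobeniusTypeProofs
import Mathlib.RingTheory.MvPowerSeries.Expand
import Mathlib.RingTheory.MvPowerSeries.Order
import HarnessLib

/-!
# Route `CyclotomicUntwist`: Katz's Theorem 5.1.4 over `ℤ_p` in kernel — the Frobenius `f ↦ f(Xᵖ)` PRESERVES
# functions of the second kind (two-variable substitution congruence `ℓ(U) ≡ ℓ(V) (mod p)`; `G(X,Y)ᵖ ≡ G(Xᵖ,Yᵖ)
# (mod p)`; the coboundary `∂_G(f(Xᵖ))` stays bounded)

Cell `pub/bsd-wall` (D-0145 line `route-BirchSwinnertonDyer-CyclotomicUntwist`), prover seat `bsd-line-cycu-p2`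
(gen 6), lane «D5 TYPING» (memo `Cruxes/PSRankOneLowerHalfAtThree/D5-TYPING-v1.md` §2, §4 row "Katz 5.1.3
two-variable"). THEOREMS ONLY (no definition, no named fact, no `sorry`); helper `--supports` K1 =
stmt-BirchSwinnertonDyer-21580 (serves K2 = 21581 equally). BSD is not proved by this file and no crux is.

KATZ'S MODEL (LNM 868, Lemma 5.1.2 / Key Lemma 5.1.3 / Thm 5.1.4, rational form). For a one-dimensional formal group
law `G ∈ ℤ_p⟦X,Y⟧` (read in `ℚ_p⟦X,Y⟧`), a series `f ∈ ℚ_p⟦X⟧` is OF THE SECOND KIND when `n·[Xⁿ]f ∈ ℤ_p` for all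
`n` (`df` integral) and its coboundary `∂_G f := f(G(X,Y)) − f(X) − f(Y)` has BOUNDED coefficients; `D(G/ℤ_p)_ℚ` is
the quotient by the series with bounded coefficients, and `[log_G]` is a class (`∂ log = 0`). The Frobenius of the
Dieudonné crystal is induced by the pointed lift `X ↦ Xᵖ` of the relative Frobenius (Katz 5.1.4 with the divided-power
ideal `(p)`): `F[f] := [f(Xᵖ)]`. This file proves, WITHOUT defining anything, that `F` is well defined on these classes:

* §1 (Katz 5.1.3 in two variables) `norm_mvCoeff_subst_sub_subst_le`: if `n·[Xⁿ]ℓ ∈ ℤ_p` and `U ≡ V (mod p)` are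
  `p`-integral series in `ℚ_p⟦σ⟧` without constant term, then `ℓ(U) ≡ ℓ(V) (mod p)` coefficientwise — the
  `σ = Fin 2` companion of the tree's one-variable `norm_coeff_subst_sub_subst_le_of_natCast_mul_coeff_le`
  (`ℓ(U) − ℓ(V) = Σₘ ℓₘ(Uᵐ − Vᵐ)` with `mp ∣ Uᵐ − Vᵐ`);
* §2 `norm_mvCoeff_pow_sub_expand_le`: `G(X,Y)ᵖ ≡ G(Xᵖ,Yᵖ) (mod p)` for `p`-integral `G` (Mathlib's
  `MvPowerSeries.map_frobenius_expand` over `𝔽_p`);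
* §3 `secondKind_expand`: if `f` is of the second kind for `G` with `‖∂_G f‖ ≤ B` then so is `f(Xᵖ) = expand p f`:
  `n·[Xⁿ]f(Xᵖ) ∈ ℤ_p` and `‖∂_G(f(Xᵖ))‖ ≤ max B p⁻¹` — since `∂_G(f(Xᵖ)) = (f(Gᵖ) − f(G(Xᵖ,Yᵖ))) + (∂_G f)(Xᵖ,Yᵖ)`;
  bounded (exact) series stay bounded (`CyclotomicUntwistSecondKindLogClasses.norm_coeff_expand_le`);
* §4 for a `p`-integral Weierstrass equation: `[log_W(X^{pᵏ})]` is of the second kind for every `k`, with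
  `‖∂‖ ≤ p⁻¹` (`secondKind_expand_pow_formalLog`) — the classes `[log₀], [log₀(X³)], [log₀(X⁹)], [log₀(X²⁷)]` used by
  the D5 pin (`…SecondKindLogClassesLift`, `Lines/D5_pin_candidate.lean`) are honest elements of Katz's `D(Ĝ₀/ℤ₃)_ℚ`.
[cite: Katz1981CrystallineDieudonne, §5 (5.1.2–5.1.4)] [cite: Honda1970, §2] [cite: Hazewinkel1978, Ch. I §2.3]
-/

set_option autoImplicit false
-- single-conjunct summit: `Summit.BirchSwinnertonDyer.BirchSwinnertonDyer.…` repeats the name by design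
set_option linter.dupNamespace false

noncomputable section

open PowerSeries Literature.RingTheory.FormalGroups Literature.NumberTheory.EllipticCurves

namespace Summit.BirchSwinnertonDyer.BirchSwinnertonDyer.Theorems.SecondKindFrobenius

variable {p : ℕ} [hp : Fact p.Prime] {σ : Type*}

/-! ## §1 Katz's Key Lemma 5.1.3 in several variables: `ℓ(U) ≡ ℓ(V) (mod p)` -/

/-- **Only the coefficients `ℓ_i`, `i ≤ |d|`, enter `[X^d] ℓ(Γ)`** (`Γ(0) = 0`):
`[X^d] ℓ(Γ) = Σ_{i ≤ |d|} ℓ_i·[X^d] Γⁱ`. [folklore] -/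
theorem mvCoeff_subst_eq_sum {Γ : MvPowerSeries σ ℚ_[p]} (hΓ : MvPowerSeries.constantCoeff Γ = 0)
    (g : ℚ_[p]⟦X⟧) (d : σ →₀ ℕ) :
    MvPowerSeries.coeff d (g.subst Γ) =
      ∑ i ∈ Finset.range (Finsupp.degree d + 1), coeff i g * MvPowerSeries.coeff d (Γ ^ i) := by
  have hs : HasSubst Γ := HasSubst.of_constantCoeff_zero hΓ
  rw [coeff_subst hs, finsum_eq_sum_of_support_subset _ (s := Finset.range (Finsupp.degree d + 1))]
  · simp only [smul_eq_mul]
  · intro i hi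
    rw [Function.mem_support] at hi
    rw [Finset.coe_range, Set.mem_Iio]
    by_contra h
    rw [not_lt] at h
    apply hi
    have hord : MvPowerSeries.coeff d (Γ ^ i) = 0 := by
      refine MvPowerSeries.coeff_of_lt_order ?_
      refine lt_of_lt_of_le ?_ (MvPowerSeries.le_order_pow_of_constantCoeff_eq_zero i hΓ)
      exact_mod_cast Nat.lt_of_lt_of_le (Nat.lt_succ_self _) h
    rw [hord, smul_zero]

omit hp in
/-- In `ℤ_p⟦σ⟧` every natural number prime to `p` is a unit. [folklore] -/
theorem isUnit_natCast_mvPowerSeries {r : ℕ} [Fact p.Prime] (hr : ¬ p ∣ r) :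
    IsUnit (r : MvPowerSeries σ ℤ_[p]) := by
  have h : IsUnit (r : ℤ_[p]) := by
    rw [PadicInt.isUnit_iff, PadicInt.norm_natCast_eq_one_iff]
    exact (Nat.Prime.coprime_iff_not_dvd (Fact.out : p.Prime)).mpr hr
  simpa using h.map (MvPowerSeries.C : ℤ_[p] →+* MvPowerSeries σ ℤ_[p])

/-- `mp ∣ Uᵐ − Vᵐ` in `ℤ_p⟦σ⟧` when `p ∣ U − V`. [cite: Hazewinkel1978, Ch. I §2.3] -/
theorem natCast_mul_dvd_pow_sub_pow_mv {U V : MvPowerSeries σ ℤ_[p]} (h : (p : MvPowerSeries σ ℤ_[p]) ∣ U - V)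
    (m : ℕ) : ((m : MvPowerSeries σ ℤ_[p]) * p) ∣ U ^ m - V ^ m :=
  natCast_mul_dvd_pow_sub_pow hp.out.ne_one (fun _ hr => isUnit_natCast_mvPowerSeries hr) h m

/-- Lift of a congruence `U ≡ V (mod p)` between integral series of `ℚ_p⟦σ⟧` to a divisibility in `ℤ_p⟦σ⟧`.
[folklore] -/
theorem C_natCast_dvd_sub_mv {U V : MvPowerSeries σ ℤ_[p]}
    (huv : ∀ d, ‖MvPowerSeries.coeff d (U.map (PadicInt.Coe.ringHom (p := p)) -
      V.map (PadicInt.Coe.ringHom (p := p)))‖ ≤ (p : ℝ)⁻¹) :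
    (p : MvPowerSeries σ ℤ_[p]) ∣ U - V := by
  have hdvd : ∀ d, (p : ℤ_[p]) ∣ MvPowerSeries.coeff d (U - V) := fun d ↦ by
    rw [← padicInt_norm_le_inv_iff_dvd, PadicInt.norm_def, map_sub, PadicInt.coe_sub]
    have := huv d
    rwa [map_sub, MvPowerSeries.coeff_map, MvPowerSeries.coeff_map] at this
  choose c hc using hdvd
  refine ⟨fun d ↦ c d, ?_⟩
  ext d
  rw [show (p : MvPowerSeries σ ℤ_[p]) = MvPowerSeries.C (p : ℤ_[p]) from (map_natCast MvPowerSeries.C p).symm,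
    MvPowerSeries.coeff_C_mul]
  exact hc d

/-- **Katz's Key Lemma 5.1.3 (two variables, rational form): `ℓ(U) ≡ ℓ(V) (mod p)`.** Let `ℓ ∈ ℚ_p⟦X⟧` have
`n·[Xⁿ]ℓ ∈ ℤ_p` for all `n` (`dℓ` integral — e.g. a formal-group logarithm), and let `U, V ∈ ℚ_p⟦σ⟧` be
`p`-integral, without constant term, with `U ≡ V (mod p)` coefficientwise. Then every coefficient of `ℓ(U) − ℓ(V)`
has norm `≤ p⁻¹`: `ℓ(U) − ℓ(V) = Σₘ ℓₘ(Uᵐ − Vᵐ)` and `mp ∣ Uᵐ − Vᵐ` absorbs the denominator of `ℓₘ`.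
[cite: Katz1981CrystallineDieudonne, §5 Key Lemma 5.1.3] [cite: Hazewinkel1978, Ch. I §2.3] -/
theorem norm_mvCoeff_subst_sub_subst_le {ℓ : ℚ_[p]⟦X⟧} (hℓ : ∀ n : ℕ, ‖(n : ℚ_[p]) * coeff n ℓ‖ ≤ 1)
    {U V : MvPowerSeries σ ℚ_[p]} (hU0 : MvPowerSeries.constantCoeff U = 0) (hU : IsPadicInt U)
    (hV0 : MvPowerSeries.constantCoeff V = 0) (hV : IsPadicInt V)
    (hUV : ∀ d, ‖MvPowerSeries.coeff d (U - V)‖ ≤ (p : ℝ)⁻¹) (d : σ →₀ ℕ) :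
    ‖MvPowerSeries.coeff d (ℓ.subst U - ℓ.subst V)‖ ≤ (p : ℝ)⁻¹ := by
  obtain ⟨U', rfl⟩ := isPadicInt_iff_exists_map.mp hU
  obtain ⟨V', rfl⟩ := isPadicInt_iff_exists_map.mp hV
  have hUV' : (p : MvPowerSeries σ ℤ_[p]) ∣ U' - V' := C_natCast_dvd_sub_mv hUV
  rw [map_sub, mvCoeff_subst_eq_sum hU0, mvCoeff_subst_eq_sum hV0, ← Finset.sum_sub_distrib]
  refine IsUltrametricDist.norm_sum_le_of_forall_le_of_nonneg (inv_nonneg.mpr (Nat.cast_nonneg p))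
    fun m _ ↦ ?_
  rw [← mul_sub, ← map_pow, ← map_pow, ← map_sub, ← map_sub]
  obtain ⟨w, hw⟩ := natCast_mul_dvd_pow_sub_pow_mv hUV' m
  rw [hw, show ((m : MvPowerSeries σ ℤ_[p]) * (p : MvPowerSeries σ ℤ_[p])) =
      MvPowerSeries.C ((m : ℤ_[p]) * (p : ℤ_[p])) by rw [map_mul, map_natCast, map_natCast], map_mul,
    MvPowerSeries.map_C, MvPowerSeries.coeff_C_mul, ← mul_assoc, norm_mul]
  have h1 : ‖coeff m ℓ * PadicInt.Coe.ringHom ((m : ℤ_[p]) * (p : ℤ_[p]))‖ ≤ (p : ℝ)⁻¹ := by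
    rw [map_mul, map_natCast, map_natCast, ← mul_assoc, norm_mul, mul_comm (coeff m ℓ), Padic.norm_p]
    exact mul_le_of_le_one_left (inv_nonneg.mpr (Nat.cast_nonneg p)) (hℓ m)
  have h2 : ‖MvPowerSeries.coeff d (w.map (PadicInt.Coe.ringHom (p := p)))‖ ≤ 1 := by
    rw [MvPowerSeries.coeff_map]; exact PadicInt.norm_le_one _
  calc _ ≤ (p : ℝ)⁻¹ * 1 := mul_le_mul h1 h2 (norm_nonneg _) (inv_nonneg.mpr (Nat.cast_nonneg p))
    _ = (p : ℝ)⁻¹ := mul_one _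

/-! ## §2 `G(X,Y)ᵖ ≡ G(Xᵖ, Yᵖ) (mod p)` for integral `G` -/

/-- Over `𝔽_p`: `Ḡᵖ = Ḡ(Xᵖ, Yᵖ)` (Frobenius is the identity on the coefficients). [folklore] -/
theorem pow_prime_eq_expand_zmod_mv (G : MvPowerSeries σ (ZMod p)) :
    G ^ p = MvPowerSeries.expand p (prime_ne_zero p) G := by
  haveI : ExpChar (ZMod p) p := ExpChar.prime hp.out
  have h := MvPowerSeries.map_frobenius_expand p (prime_ne_zero p) (f := G)
  rw [ZMod.frobenius_zmod, MvPowerSeries.map_id] at h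
  exact h.symm

/-- **`G(X,Y)ᵖ ≡ G(Xᵖ,Yᵖ) (mod p)` for `p`-integral `G ∈ ℚ_p⟦σ⟧`.** [folklore] -/
theorem norm_mvCoeff_pow_sub_expand_le {G : MvPowerSeries σ ℚ_[p]} (hG : IsPadicInt G) (d : σ →₀ ℕ) :
    ‖MvPowerSeries.coeff d (G ^ p - MvPowerSeries.expand p (prime_ne_zero p) G)‖ ≤ (p : ℝ)⁻¹ := by
  obtain ⟨G', rfl⟩ := isPadicInt_iff_exists_map.mp hG
  have hD : (G' ^ p - MvPowerSeries.expand p (prime_ne_zero p) G').map (PadicInt.toZMod (p := p)) = 0 := by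
    rw [map_sub, map_pow, MvPowerSeries.map_expand, sub_eq_zero]
    exact pow_prime_eq_expand_zmod_mv _
  have h0 : PadicInt.toZMod (MvPowerSeries.coeff d (G' ^ p - MvPowerSeries.expand p (prime_ne_zero p) G')) = 0 := by
    rw [← MvPowerSeries.coeff_map, hD, map_zero]
  have hmem : MvPowerSeries.coeff d (G' ^ p - MvPowerSeries.expand p (prime_ne_zero p) G') ∈
      RingHom.ker (PadicInt.toZMod (p := p)) := h0
  rw [PadicInt.ker_toZMod, IsLocalRing.mem_maximalIdeal, mem_nonunits_iff, PadicInt.not_isUnit_iff] at hmem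
  have e : G'.map (PadicInt.Coe.ringHom (p := p)) ^ p -
      MvPowerSeries.expand p (prime_ne_zero p) (G'.map (PadicInt.Coe.ringHom (p := p))) =
      (G' ^ p - MvPowerSeries.expand p (prime_ne_zero p) G').map PadicInt.Coe.ringHom := by
    rw [map_sub, map_pow, MvPowerSeries.map_expand]
  rw [e, MvPowerSeries.coeff_map]
  exact norm_le_inv_of_norm_lt_one hmem

/-! ## §3 `f ↦ f(Xᵖ)` preserves functions of the second kind -/

section SecondKind

variable {G : MvPowerSeries (Fin 2) ℚ_[p]}

omit hp in
/-- `(expand p f)(Γ) = f(Γᵖ)` for any substituable `Γ`. [folklore] -/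
theorem expand_subst_eq_subst_pow [Fact p.Prime] {τ : Type*} {Γ : MvPowerSeries τ ℚ_[p]}
    (hΓ : MvPowerSeries.constantCoeff Γ = 0) (f : ℚ_[p]⟦X⟧) :
    (expand p (prime_ne_zero p) f).subst Γ = f.subst (Γ ^ p) := by
  have hs : HasSubst Γ := HasSubst.of_constantCoeff_zero hΓ
  rw [expand_apply, subst_comp_subst_apply (PowerSeries.HasSubst.X_pow (prime_ne_zero p)) hs, subst_pow hs,
    subst_X hs]

omit hp in
/-- `f(Γ(Xᵖ,Yᵖ)) = (f(Γ))(Xᵖ,Yᵖ)`: substitution commutes with `expand`. [folklore] -/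
theorem subst_expand_eq_expand_subst [Fact p.Prime] {τ : Type*} {Γ : MvPowerSeries τ ℚ_[p]}
    (hΓ : MvPowerSeries.constantCoeff Γ = 0) (f : ℚ_[p]⟦X⟧) :
    f.subst (MvPowerSeries.expand p (prime_ne_zero p) Γ) =
      MvPowerSeries.expand p (prime_ne_zero p) (f.subst Γ) := by
  have hs : HasSubst Γ := HasSubst.of_constantCoeff_zero hΓ
  rw [PowerSeries.subst, PowerSeries.subst, MvPowerSeries.expand_subst _ _ hs.const]

/-- **`d(f(Xᵖ))` is integral when `df` is**: `n·[Xⁿ]f(Xᵖ) ∈ ℤ_p` (the coefficient is `f_{n/p}` and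
`‖(pm)·f_m‖ = p⁻¹‖m·f_m‖`). [cite: Katz1981CrystallineDieudonne, §5] -/
theorem norm_natCast_mul_coeff_expand_le {f : ℚ_[p]⟦X⟧} (hf : ∀ n : ℕ, ‖(n : ℚ_[p]) * coeff n f‖ ≤ 1) (n : ℕ) :
    ‖(n : ℚ_[p]) * coeff n (expand p (prime_ne_zero p) f)‖ ≤ 1 := by
  rw [coeff_expand]
  split_ifs with h
  · obtain ⟨m, rfl⟩ := h
    rw [Nat.mul_div_cancel_left _ hp.out.pos, Nat.cast_mul, mul_assoc, norm_mul, Padic.norm_p]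
    calc (p : ℝ)⁻¹ * ‖(m : ℚ_[p]) * coeff m f‖ ≤ 1 * 1 := by
          gcongr
          · exact inv_le_one_of_one_le₀ (by exact_mod_cast hp.out.one_le)
          · exact hf m
      _ = 1 := mul_one _
  · rw [mul_zero, norm_zero]; exact zero_le_one

/-- **The coboundary of `f(Xᵖ)` decomposes** as `(f(Gᵖ) − f(G(Xᵖ,Yᵖ))) + (∂_G f)(Xᵖ,Yᵖ)`.
[cite: Katz1981CrystallineDieudonne, §5 Thm 5.1.4] -/
theorem coboundary_expand_eq (hG0 : MvPowerSeries.constantCoeff G = 0) (f : ℚ_[p]⟦X⟧) :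
    (expand p (prime_ne_zero p) f).subst G - (expand p (prime_ne_zero p) f).subst (MvPowerSeries.X 0) -
        (expand p (prime_ne_zero p) f).subst (MvPowerSeries.X 1) =
      (f.subst (G ^ p) - f.subst (MvPowerSeries.expand p (prime_ne_zero p) G)) +
        MvPowerSeries.expand p (prime_ne_zero p)
          (f.subst G - f.subst (MvPowerSeries.X 0) - f.subst (MvPowerSeries.X 1)) := by
  have hX : ∀ i : Fin 2, MvPowerSeries.constantCoeff (MvPowerSeries.X i : MvPowerSeries (Fin 2) ℚ_[p]) = 0 :=
    fun i ↦ MvPowerSeries.constantCoeff_X i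
  rw [expand_subst_eq_subst_pow hG0, expand_subst_eq_subst_pow (hX 0), expand_subst_eq_subst_pow (hX 1),
    map_sub, map_sub, ← subst_expand_eq_expand_subst hG0, ← subst_expand_eq_expand_subst (hX 0),
    ← subst_expand_eq_expand_subst (hX 1), MvPowerSeries.expand_X, MvPowerSeries.expand_X]
  ring

/-- Coefficients of `Φ(Xᵖ,Yᵖ)` are coefficients of `Φ` (or `0`): a bound `‖[X^d]Φ‖ ≤ B` (`B ≥ 0`) transfers.
[folklore] -/
theorem norm_mvCoeff_expand_le {Φ : MvPowerSeries (Fin 2) ℚ_[p]} {B : ℝ} (hB : 0 ≤ B)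
    (h : ∀ d, ‖MvPowerSeries.coeff d Φ‖ ≤ B) (d : Fin 2 →₀ ℕ) :
    ‖MvPowerSeries.coeff d (MvPowerSeries.expand p (prime_ne_zero p) Φ)‖ ≤ B := by
  by_cases hd : ∀ i, p ∣ d i
  · -- `d = p • m`
    choose m hm using hd
    have e : d = p • (Finsupp.equivFunOnFinite.symm m : Fin 2 →₀ ℕ) := by
      ext i; simp [hm i]
    rw [e, MvPowerSeries.coeff_expand_smul]
    exact h _
  · obtain ⟨i, hi⟩ := not_forall.mp hd
    rw [MvPowerSeries.coeff_expand_of_not_dvd p (prime_ne_zero p) Φ hi, norm_zero]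
    exact hB

/-- **Katz 5.1.4 for the Frobenius lift `X ↦ Xᵖ` (rational form): `f ↦ f(Xᵖ)` preserves the second kind.**
If `G ∈ ℚ_p⟦X,Y⟧` is `p`-integral without constant term, `n·[Xⁿ]f ∈ ℤ_p` for all `n`, and the coboundary
`∂_G f = f(G) − f(X) − f(Y)` has coefficients of norm `≤ B`, then `f(Xᵖ)` has `n·[Xⁿ]f(Xᵖ) ∈ ℤ_p` and coboundary
bounded by `max B p⁻¹`. [cite: Katz1981CrystallineDieudonne, §5 Thm 5.1.4] -/
theorem secondKind_expand (hG0 : MvPowerSeries.constantCoeff G = 0) (hG : IsPadicInt G) {f : ℚ_[p]⟦X⟧}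
    (hf : ∀ n : ℕ, ‖(n : ℚ_[p]) * coeff n f‖ ≤ 1) {B : ℝ}
    (hcob : ∀ d, ‖MvPowerSeries.coeff d (f.subst G - f.subst (MvPowerSeries.X 0) - f.subst (MvPowerSeries.X 1))‖ ≤ B) :
    (∀ n : ℕ, ‖(n : ℚ_[p]) * coeff n (expand p (prime_ne_zero p) f)‖ ≤ 1) ∧
    ∀ d, ‖MvPowerSeries.coeff d ((expand p (prime_ne_zero p) f).subst G -
        (expand p (prime_ne_zero p) f).subst (MvPowerSeries.X 0) -
        (expand p (prime_ne_zero p) f).subst (MvPowerSeries.X 1))‖ ≤ max B (p : ℝ)⁻¹ := by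
  refine ⟨norm_natCast_mul_coeff_expand_le hf, fun d ↦ ?_⟩
  have hB : 0 ≤ B := le_trans (norm_nonneg _) (hcob 0)
  rw [coboundary_expand_eq hG0]
  refine le_trans (IsUltrametricDist.norm_add_le_max _ _) (max_le ?_ ?_)
  · -- `f(Gᵖ) − f(G(Xᵖ,Yᵖ))`: Key Lemma 5.1.3 with `U = Gᵖ ≡ V = G(Xᵖ,Yᵖ)`
    refine le_trans ?_ (le_max_right _ _)
    refine norm_mvCoeff_subst_sub_subst_le hf ?_ (hG.pow p) ?_ ?_ (norm_mvCoeff_pow_sub_expand_le hG) d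
    · rw [map_pow, hG0, zero_pow hp.out.ne_zero]
    · rw [MvPowerSeries.constantCoeff_expand, hG0]
    · rw [MvPowerSeries.expand, MvPowerSeries.substAlgHom_apply]
      exact IsPadicInt.subst hG (fun s ↦ (IsPadicInt.X s).pow p)
        (MvPowerSeries.HasSubst.X_pow (prime_ne_zero p))
  · exact le_trans (norm_mvCoeff_expand_le hB hcob d) (le_max_left _ _)

end SecondKind

/-! ## §4 For a `p`-integral Weierstrass equation: every `[log_W(X^{pᵏ})]` is of the second kind -/

section Weierstrass

variable (W : WeierstrassCurve ℚ_[p]) [hW : W.IsIntegral ℤ_[p]]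

omit hW in
/-- `∂ log_W = 0`: the logarithm is a homomorphism to `𝔾_a` (tree: `formalLog_subst_formalGroupLaw`), so its
coboundary has every bound `≥ 0`. [cite: SilvermanAEC2009, IV.5.2] -/
theorem coboundary_formalLog_eq_zero :
    W.formalLog.subst W.formalGroupLaw - W.formalLog.subst (MvPowerSeries.X 0) -
      W.formalLog.subst (MvPowerSeries.X 1) = 0 := by
  rw [W.formalLog_subst_formalGroupLaw]; ring

/-- **`[log_W(X^{pᵏ})] ∈ D(Ŵ/ℤ_p)_ℚ` for every `k`**: `n·[Xⁿ]log_W(X^{pᵏ}) ∈ ℤ_p` and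
`‖∂_Ŵ(log_W(X^{pᵏ}))‖ ≤ p⁻¹` coefficientwise. (`k = 0`: `∂ = 0`; induction by `secondKind_expand` with
`expand (p·pᵏ) = expand p ∘ expand pᵏ`.) [cite: Katz1981CrystallineDieudonne, §5 Thm 5.1.4] -/
theorem secondKind_expand_pow_formalLog (k : ℕ) :
    (∀ n : ℕ, ‖(n : ℚ_[p]) * coeff n (expand (p ^ k) (pow_ne_zero k (prime_ne_zero p)) W.formalLog)‖ ≤ 1) ∧
    ∀ d, ‖MvPowerSeries.coeff d ((expand (p ^ k) (pow_ne_zero k (prime_ne_zero p)) W.formalLog).subst W.formalGroupLaw -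
        (expand (p ^ k) (pow_ne_zero k (prime_ne_zero p)) W.formalLog).subst (MvPowerSeries.X 0) -
        (expand (p ^ k) (pow_ne_zero k (prime_ne_zero p)) W.formalLog).subst (MvPowerSeries.X 1))‖ ≤ (p : ℝ)⁻¹ := by
  have hp0 : (0 : ℝ) ≤ (p : ℝ)⁻¹ := inv_nonneg.mpr (Nat.cast_nonneg p)
  induction k with
  | zero =>
    have e : expand (p ^ 0) (pow_ne_zero 0 (prime_ne_zero p)) W.formalLog = W.formalLog := by
      ext n; simp
    rw [e]
    refine ⟨W.norm_natCast_mul_coeff_formalLog_le, fun d ↦ ?_⟩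
    rw [coboundary_formalLog_eq_zero, map_zero, norm_zero]; exact hp0
  | succ k ih =>
    obtain ⟨ih1, ih2⟩ := ih
    have e : expand (p ^ (k + 1)) (pow_ne_zero (k + 1) (prime_ne_zero p)) W.formalLog =
        expand p (prime_ne_zero p) (expand (p ^ k) (pow_ne_zero k (prime_ne_zero p)) W.formalLog) := by
      rw [← expand_mul]
      ext n
      simp only [coeff_expand, pow_succ']
    rw [e]
    have key := secondKind_expand W.constantCoeff_formalGroupLaw W.isPadicInt_formalGroupLaw ih1 ih2
    refine ⟨key.1, fun d ↦ ?_⟩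
    have := key.2 d
    rwa [max_self] at this

end Weierstrass

end Summit.BirchSwinnertonDyer.BirchSwinnertonDyer.Theorems.SecondKindFrobenius
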